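import Mathlib
import HarnessLib

/-!
# Certified hcp/fcc inverse-power lattice sums: definitions

Vocabulary of the certified comparison of the Lennard-Jones lattice energies of the hexagonal
close packing (hcp, stacking `ABAB…`) and the face-centred cubic packing (fcc, `ABCABC…`)
(`HcpFccLatticeSums*.lean`; headline `LennardJonesHcpBelowFcc.lean`).  Units: nearest-neighbour
(in-layer) spacing `1`, layer spacing `c` (ideal close packing: `c² = 2/3`).

* `stackForm δ i j = i² + ij + j² + δ (i + j + 1/3)` — squared in-plane distance from a site to the
  point `(i, j)` of a triangular layer laterally offset by `δ` letters (`δ = 0`: aligned layer,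
  `δ = 1`: offset by the hole vector `w`, `|w|² = 1/3`); `layerTerm δ n s (i,j) = (stackForm δ i j + s)⁻ⁿ`
  and the layer sums `layerSum δ n s = ∑_{(i,j) ∈ ℤ²} (Q_δ + s)⁻ⁿ` (`s` = squared layer distance);
  `registryCoupling n s = layerSum 0 n s − layerSum 1 n s` is the interlayer registry coupling
  `J(s)` of the inverse power `r^{-2n}` (aligned minus offset; the `barlowCoupling` of
  `BarlowStackingEnergy.lean` for `V r = r^{-2n}`, `a = 1`).
* `hcpForm`, `fccForm` — the index forms of the two stackings: the site `(k, i, j)` (layer `k`,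
  in-layer indices `i, j`) has squared norm `hcpForm v + k² c²` resp. `fccForm v + k² c²`
  (hcp: layer `k` is offset by `[k odd]` letters; fcc: by `k` letters, `|i u + j v + k w|² =
  i² + ij + j² + ik + jk + k²/3`, so that at `c² = 2/3` the fcc squared norm is the `A₃` form
  `i² + j² + k² + ij + jk + ki`); `hcpTerm/fccTerm n c v = [v ≠ 0] (form + k²c²)⁻ⁿ` and the lattice
  sums `hcpInvPowSum n c = ∑_{v ≠ 0} ‖v‖^{-2n}`, `fccInvPowSum n c` (so `n = 3, 6` are the
  `L₆, L₁₂` of Stillinger / Schwerdtfeger–Burrows–Smits: `L₆ᶠᶜᶜ = 14.45392…`, `L₁₂ᶠᶜᶜ = 12.13188…`,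
  `L₆ʰᶜᵖ = 14.45490…`, `L₁₂ʰᶜᵖ = 12.13229…` at `c² = 2/3`).
* The kernel evaluator: at `c² = p/q`, `stackForm δ i j + k² c² = latticeNum p q δ k i j / (3q)` with
  the INTEGER `latticeNum = q (3(i² + ij + j²) + δ (3i + 3j + 1)) + 3 p k²`; `boxFloorSum p q δ k R n M
  = ∑_{|i|,|j| ≤ R} ⌊M / latticeNumⁿ⌋` (origin skipped when `k = 0`), written by structural recursion
  (`boxLoopJ`, `boxLoopI`) so that `decide +kernel` evaluates it with GMP arithmetic; `box R` is the
  index square `[-R, R]²`.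

Design.  `layerTerm` carries no puncture: at `δ = 0`, `s = 0`, `(i,j) = 0` its value is
`(0⁻¹)ⁿ = 0` (`n ≥ 1`), which IS the intended omission of the site itself from its own layer, so
`hcpTerm n c (k,i,j) = layerTerm [k odd] n (k²c²) (i,j)` holds for every index
(`HcpFccLatticeSumsLayers.lean`).  Soundness of the evaluator, tail bounds, the layer decomposition
and the certificate are theorems of the sibling files; this file only fixes vocabulary.

## References
* F. H. Stillinger, *Lattice sums and their phase diagram implications for the classical
  Lennard-Jones model*, J. Chem. Phys. 115 (2001) 5208–5212, §II (lattice sums of fcc and hcp).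
* P. Schwerdtfeger, A. Burrows, O. R. Smits, *The Lennard-Jones potential revisited*, J. Phys.
  Chem. A 125 (2021) 3037–3057, §2 eq. (6)–(8) and the values `L₆, L₁₂` (arXiv:2012.05413 p. 8).
* J. H. Conway, N. J. A. Sloane, *Sphere packings, lattices and groups*, Ch. 1 §1.3 / Ch. 4 §6.3
  (hcp and fcc as stackings of triangular layers; the `A₃ = D₃` Gram form).
-/

noncomputable section

namespace Literature.MathematicalPhysics.StatisticalMechanics.StackingSums

/-! ## Layer sums -/

/-- **The pattern form** `Q_δ(i,j) = i² + ij + j² + δ·(i + j + 1/3)`: squared in-plane distance from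
a site to the point `(i,j)` of a unit triangular layer laterally offset by `δ` letters
(`δ = 1`: `|i u + j v + w|²`, `w = (u+v)/3`). [cite: ConwaySloane1999, Ch. 1 §1.3] -/
def stackForm (δ : ℕ) (i j : ℤ) : ℝ :=
  (i : ℝ) ^ 2 + (i : ℝ) * j + (j : ℝ) ^ 2 + (δ : ℝ) * ((i : ℝ) + j + 1 / 3)

/-- **The layer term** `(Q_δ(i,j) + s)⁻ⁿ` (`s` the squared distance to the layer).  No puncture is
built in: for `δ = 0`, `s = 0`, `(i,j) = 0` the value is `(0⁻¹)ⁿ = 0` for `n ≥ 1`, the intended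
omission of the site itself. [folklore] -/
def layerTerm (δ n : ℕ) (s : ℝ) (ij : ℤ × ℤ) : ℝ :=
  ((stackForm δ ij.1 ij.2 + s)⁻¹) ^ n

/-- **The layer sum** `∑_{(i,j) ∈ ℤ²} (Q_δ(i,j) + s)⁻ⁿ` (a `tsum`; summable for `n ≥ 2`, `s ≥ 0`,
`HcpFccLatticeSumsTail.lean`). [folklore] -/
def layerSum (δ n : ℕ) (s : ℝ) : ℝ :=
  ∑' ij : ℤ × ℤ, layerTerm δ n s ij

/-- **The registry coupling** of the inverse power `r^{-2n}` at squared layer distance `s`: aligned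
minus offset layer sum, `J⁽ⁿ⁾(s) = ∑_{(i,j)} [(Q₀ + s)⁻ⁿ − (Q₁ + s)⁻ⁿ]`.
[cite: SchwerdtfegerBurrowsSmits2021, §2] -/
def registryCoupling (n : ℕ) (s : ℝ) : ℝ :=
  layerSum 0 n s - layerSum 1 n s

/-! ## The two stackings indexed by `ℤ³` -/

/-- **The hcp index form** `Q(k,i,j) = i² + ij + j² + [k odd](i + j + 1/3)`: the site `(k,i,j)` of
`hcp(1, c)` (layer `k`, offset by one letter on odd layers) has squared norm `Q + k²c²`.  Literally
the form of the tree's hcp energy series. [cite: ConwaySloane1999, Ch. 1 §1.3] -/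
def hcpForm (v : ℤ × ℤ × ℤ) : ℝ :=
  (v.2.1 : ℝ) ^ 2 + (v.2.1 : ℝ) * v.2.2 + (v.2.2 : ℝ) ^ 2 +
    (if Even v.1 then 0 else ((v.2.1 : ℝ) + v.2.2 + 1 / 3))

/-- **The fcc index form** `i² + ij + j² + ik + jk + k²/3 = |i u + j v + k w|²`: the site `(k,i,j)`
of the `ABC` stacking with unit in-layer spacing (layer `k` offset by `k` letters) has squared norm
`fccForm v + k²c²`; at the cubic ratio `c² = 2/3` this is the `A₃` Gram form `i² + j² + k² + ij + jk + ki`.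
[cite: ConwaySloane1999, Ch. 4 §6.3] -/
def fccForm (v : ℤ × ℤ × ℤ) : ℝ :=
  (v.2.1 : ℝ) ^ 2 + (v.2.1 : ℝ) * v.2.2 + (v.2.2 : ℝ) ^ 2 +
    ((v.2.1 : ℝ) * v.1 + (v.2.2 : ℝ) * v.1 + (v.1 : ℝ) ^ 2 / 3)

/-- The hcp inverse-power term `[v ≠ 0] (hcpForm v + k²c²)⁻ⁿ`. [folklore] -/
def hcpTerm (n : ℕ) (c : ℝ) (v : ℤ × ℤ × ℤ) : ℝ :=
  if v = 0 then 0 else ((hcpForm v + (v.1 : ℝ) ^ 2 * c ^ 2)⁻¹) ^ n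

/-- The fcc inverse-power term `[v ≠ 0] (fccForm v + k²c²)⁻ⁿ`. [folklore] -/
def fccTerm (n : ℕ) (c : ℝ) (v : ℤ × ℤ × ℤ) : ℝ :=
  if v = 0 then 0 else ((fccForm v + (v.1 : ℝ) ^ 2 * c ^ 2)⁻¹) ^ n

/-- **The hcp lattice sum** `∑_{v ≠ 0} ‖v‖^{-2n}` of `hcp(1, c)` (`n = 3`: `L₆ʰᶜᵖ = 14.45490…`,
`n = 6`: `L₁₂ʰᶜᵖ = 12.13229…` at `c² = 2/3`). [cite: Stillinger2001, §II] -/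
def hcpInvPowSum (n : ℕ) (c : ℝ) : ℝ :=
  ∑' v : ℤ × ℤ × ℤ, hcpTerm n c v

/-- **The fcc lattice sum** `∑_{v ≠ 0} ‖v‖^{-2n}` of the `ABC` stacking with layer ratio `c`
(`c² = 2/3`: `L₆ᶠᶜᶜ = 14.45392…`, `L₁₂ᶠᶜᶜ = 12.13188…`). [cite: Stillinger2001, §II] -/
def fccInvPowSum (n : ℕ) (c : ℝ) : ℝ :=
  ∑' v : ℤ × ℤ × ℤ, fccTerm n c v

/-! ## The kernel evaluator (layer ratio `c² = p/q`) -/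

/-- The index square `[-R, R]² ⊆ ℤ²`. [folklore] -/
def box (R : ℕ) : Finset (ℤ × ℤ) :=
  Finset.Icc (-(R : ℤ)) R ×ˢ Finset.Icc (-(R : ℤ)) R

/-- Integer numerator `q (3(i² + ij + j²) + δ (3i + 3j + 1)) + 3 p k²` of `stackForm δ i j + k² (p/q)`
(the latter equals `latticeNum / (3q)`). [folklore] -/
def latticeNum (p q δ : ℕ) (k i j : ℤ) : ℤ :=
  (q : ℤ) * (3 * (i * i + i * j + j * j) + (δ : ℤ) * (3 * i + 3 * j + 1)) + 3 * (p : ℤ) * (k * k)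

/-- Floor term `⌊M / latticeNumⁿ⌋` at the shifted indices `(ii − R, jj − R)`; `0` at the origin of
the base layer `k = 0` (the omitted site). [folklore] -/
def boxFloorTerm (p q δ k R n M ii jj : ℕ) : ℕ :=
  if k = 0 ∧ ii = R ∧ jj = R then 0
  else M / (latticeNum p q δ k ((ii : ℤ) - R) ((jj : ℤ) - R)).toNat ^ n

/-- Inner loop `∑_{jj < m}` of the floor sum (structural recursion, kernel-evaluable). [folklore] -/
def boxLoopJ (p q δ k R n M ii : ℕ) : ℕ → ℕ
  | 0 => 0
  | m + 1 => boxLoopJ p q δ k R n M ii m + boxFloorTerm p q δ k R n M ii m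

/-- Outer loop `∑_{ii < m} ∑_{jj ≤ 2R}`. [folklore] -/
def boxLoopI (p q δ k R n M : ℕ) : ℕ → ℕ
  | 0 => 0
  | m + 1 => boxLoopI p q δ k R n M m + boxLoopJ p q δ k R n M m (2 * R + 1)

/-- **The box floor sum** `∑_{|i|,|j| ≤ R} ⌊M / latticeNum p q δ k i jⁿ⌋` (origin skipped when
`k = 0`): `(3q)ⁿ · boxFloorSum / M` is a certified lower bound of the box part of
`layerSum δ n (k² p/q)`, and an upper bound up to `(2R+1)²/M` (`HcpFccLatticeSumsEval.lean`).
[folklore] -/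
def boxFloorSum (p q δ k R n M : ℕ) : ℕ :=
  boxLoopI p q δ k R n M (2 * R + 1)


/-- The real number that `boxFloorTerm` approximates from below within `1`:
`M · [¬ omitted] / latticeNumⁿ` at the shifted indices. [folklore] -/
def boxTarget (p q δ k R n M ii jj : ℕ) : ℝ :=
  if k = 0 ∧ ii = R ∧ jj = R then 0
  else (M : ℝ) * ((latticeNum p q δ k ((ii : ℤ) - R) ((jj : ℤ) - R) : ℝ)⁻¹) ^ n

/-! ## Two index maps -/

/-- Negation preserves the index squares. [folklore] -/
theorem neg_mem_box_iff {R : ℕ} (ij : ℤ × ℤ) : -ij ∈ box R ↔ ij ∈ box R := by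
  obtain ⟨i, j⟩ := ij
  simp only [box, Finset.mem_product, Finset.mem_Icc, Prod.neg_mk]
  omega

/-- Negation as a self-equivalence of the complement of an index square (the point reflection
used to symmetrise the registry tails). [folklore] -/
def boxComplNeg (R : ℕ) : {ij : ℤ × ℤ // ij ∉ box R} ≃ {ij : ℤ × ℤ // ij ∉ box R} :=
  (Equiv.neg (ℤ × ℤ)).subtypeEquiv fun ij => by rw [Equiv.neg_apply, neg_mem_box_iff]

/-- The in-layer reindexing of fcc layer `k`: translation by `(q,q)`, `q = ⌊k/3⌋`, composed with the
point reflection when `k ≡ 2 (mod 3)` (it carries the fcc layer onto the pattern layer `[3 ∤ k]`,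
`HcpFccLatticeSumsLayers.lean`). [folklore] -/
def fccLayerEquiv (k : ℤ) : ℤ × ℤ ≃ ℤ × ℤ :=
  if k % 3 = 2 then (Equiv.addRight ((k / 3 + 1, k / 3 + 1) : ℤ × ℤ)).trans (Equiv.neg (ℤ × ℤ))
  else Equiv.addRight ((k / 3, k / 3) : ℤ × ℤ)

/-! ## Elementary read-backs -/

/-- The aligned form is `i² + ij + j²`. [folklore] -/
@[simp] theorem stackForm_zero (i j : ℤ) : stackForm 0 i j = (i : ℝ) ^ 2 + i * j + (j : ℝ) ^ 2 := by
  simp [stackForm]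

/-- The offset form is `i² + ij + j² + (i + j + 1/3)`. [folklore] -/
@[simp] theorem stackForm_one (i j : ℤ) :
    stackForm 1 i j = (i : ℝ) ^ 2 + i * j + (j : ℝ) ^ 2 + ((i : ℝ) + j + 1 / 3) := by
  simp [stackForm]

/-- `hcpForm` is the pattern form of parity `[k odd]`. [folklore] -/
theorem hcpForm_eq_stackForm (k i j : ℤ) :
    hcpForm (k, i, j) = stackForm (if Even k then 0 else 1) i j := by
  unfold hcpForm stackForm
  split_ifs <;> push_cast <;> ring

/-- A tiny sanity evaluation of the evaluator: the `3 × 3` box of the aligned base layer with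
`M = 729 = 9³` counts the six nearest neighbours, `⌊729 / 9³⌋ = 1` each (`c² = 2/3`, `n = 3`).
[folklore] -/
example : boxFloorSum 2 3 0 0 1 3 729 = 6 := by decide

end Literature.MathematicalPhysics.StatisticalMechanics.StackingSums

end
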